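import Summits.Ventures.FusionMHD.Bench.SolovevPCFNstxMercierAxisLimit
import Summits.Ventures.FusionMHD.Bench.SolovevPCFNstxMercierNearAxisProfile
import HarnessLib

/-!
# F1 / MERCIER — NSTX-like PCF Solov'ev model: the certified threshold profile is ONE `F`-free function
# `g_M(r) = √(N₀(r)/N₂(r))` of the surface label, bracketed by the six certified per-surface rows and tending to the
# certified axis value `F_M` as `r → 0⁺`
(venture LADDER-GRIDFUSION, rung F1.MERCIER; cell `gridfusion`, seat `gridfusion-model-7` (g4), 2026-08-27; NSTX-like twin; rider of «#112′ NSTX»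
and and of the profile rows of `…MercierProfile` / `…MercierNearAxisProfile` (gridfusion-sos-6).)

* `gMercNstx r := √(interceptNumNstx r / slopeNumNstx r)` — the `F`-free threshold profile (`…MercierAxisLimit` §0);
  `lcMercierThreshold_nstx`: for every `F > 0` and `0 < r < R_a/2`, the threshold `lcMercierThreshold κ₀ F R_a (q₀ F) (ε/R_a) r`
  of the record `lcGGJData κ₀ F R_a (q₀ F) (ε/R_a) F r` IS `gMercNstx r`;
* `gMercNstx_mem_of_rows` — a certified two-sided row at radius `r` (criterion at `g = hi`, failure at `g = lo`) brackets
  `lo ≤ gMercNstx r < hi`; instantiated at the six certified radii `r/a = 1, 3/4, 1/2, 1/4, 1/8, 1/16`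
  (`gMercNstx_edge_mem`, `…_q3_mem`, `…_mid_mem`, `…_q1_mem`, `…_r1o8_mem`, `…_r1o16_mem`) from the rows of
  `…Mercier{Edge,Q3,Mid,Q1,R1o8,R1o16}Threshold` BY NAME (no new numerics);
* **`tendsto_gMercNstx_axis`** — `gMercNstx r → FmercAxis` as `r → 0⁺`, `FmercAxis ∈ [FmercLo, FmercHi)` (`…MercierAxisLimit`):
  the SAME function that takes the certified values `0.0485 (a) < 0.4528 < 0.7996 < 1.0349 < 1.0974 < 1.1132 (a/16)`
  converges to the certified axis threshold `≈ 1.11855` (bracket `[FmercLo, FmercHi)` of `…NstxMercierAxis`).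
HONEST FRAMING: CERTIFIED/PROVED statements about the MODEL (ideal MHD, analytic fixed-boundary PCF Solov'ev equilibrium
[cite: PatakiCerfonFreidberg2013, §6.1], `F = RB_φ` free); Mercier is a NECESSARY local-interchange criterion; nothing here says a
plasma or device is stable; monotonicity of `gMercNstx` between the certified radii is NOT claimed (VALIDATED only). No `decide`, no kit.
-/

noncomputable section

open Real Set Filter Topology
open Literature.MathematicalPhysics.MHD Literature.MathematicalPhysics.MHD.Solovev
open Literature.MathematicalPhysics.MHD.GradShafranov Literature.MathematicalPhysics.MHD.Mercier.NearAxis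
open Summit.Ventures.FusionMHD.Models.SolovevPCF
open Summit.Ventures.FusionMHD.Models.LcMercierRegular
open Summit.Ventures.FusionMHD.Bench.SolovevPCFNstx.MercierAxisLimit

namespace Summit.Ventures.FusionMHD.Bench.SolovevPCFNstx.MercierProfileFunction

/-- The `F`-free certified-able threshold PROFILE of the NSTX-like model: `g_M(r) = √(N₀(r)/N₂(r))` with the `F`-free regular
numerators of `…MercierAxisLimit` §0. MODELLED: a functional of the analytic model. [cite: Jardin2010, §8.5.4 eq. (8.134)] -/
def gMercNstx (r : ℝ) : ℝ := Real.sqrt (interceptNumNstx r / slopeNumNstx r)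

/-- For every `F > 0` and every surface `0 < r < R_a/2`: the Mercier threshold of the record `lcGGJData κ₀ F R_a (q₀ F) (ε/R_a) F r` is
`gMercNstx r` (so it does not depend on `F`). [cite: Jardin2010, §8.5.4 eq. (8.134)] -/
theorem lcMercierThreshold_nstx {F r : ℝ} (hF : 0 < F) (hr : 0 < r) (h2r : 2 * r < NstxLike.Ra) :
    lcMercierThreshold NstxLike.kappa0 F NstxLike.Ra (NstxLike.q0 F) (NstxLike.ε / NstxLike.Ra) r = gMercNstx r := by
  obtain ⟨h2, h0⟩ := lcRegNum_nstx hF r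
  unfold gMercNstx
  rw [lcMercierThreshold_eq_regular NstxLike.Ra_pos NstxLike.kappa0_pos hF (NstxLike.q0_pos hF) hr h2r, h2, h0]

/-- **A certified two-sided row brackets the profile function:** if at radius `r` the criterion holds for the record with free
constant `hi` and fails for the record with free constant `lo > 0`, then `lo ≤ gMercNstx r < hi`. [cite: Jardin2010, §8.5.4 eq. (8.134)] -/
theorem gMercNstx_mem_of_rows {r lo hi : ℝ} (hr : 0 < r) (h2r : 2 * r < NstxLike.Ra) (hlo : 0 < lo) (hhi : 0 < hi)
    (Hhi : (lcGGJData NstxLike.kappa0 hi NstxLike.Ra (NstxLike.q0 hi) (NstxLike.ε / NstxLike.Ra) hi r).MercierCriterion)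
    (Hlo : ¬ (lcGGJData NstxLike.kappa0 lo NstxLike.Ra (NstxLike.q0 lo) (NstxLike.ε / NstxLike.Ra) lo r).MercierCriterion) :
    lo ≤ gMercNstx r ∧ gMercNstx r < hi := by
  have hR := NstxLike.Ra_pos; have hk := NstxLike.kappa0_pos
  -- slope positivity at `hi`, transported to `lo` through the F-free numerator
  have hMhi : 0 < lcMercierSlope NstxLike.kappa0 hi NstxLike.Ra (NstxLike.q0 hi) (NstxLike.ε / NstxLike.Ra) r :=
    lcMercierSlope_pos_of_mercierCriterion hR hk hhi (NstxLike.q0_pos hhi) hr h2r Hhi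
  have hN : 0 < slopeNumNstx r := by
    rw [← (lcRegNum_nstx hhi r).1]
    exact (lcMercierSlope_pos_iff_regular hR hk hhi (NstxLike.q0_pos hhi) hr h2r _).1 hMhi
  have hMlo : 0 < lcMercierSlope NstxLike.kappa0 lo NstxLike.Ra (NstxLike.q0 lo) (NstxLike.ε / NstxLike.Ra) r := by
    rw [lcMercierSlope_pos_iff_regular hR hk hlo (NstxLike.q0_pos hlo) hr h2r, (lcRegNum_nstx hlo r).1]
    exact hN
  constructor
  · have h := (not_mercierCriterion_lcGGJData_iff_abs_le hR hk hlo (NstxLike.q0_pos hlo) hr h2r hMlo lo).1 Hlo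
    rw [abs_of_pos hlo, lcMercierThreshold_nstx hlo hr h2r] at h
    exact h
  · have h := (mercierCriterion_lcGGJData_iff_threshold_lt_abs hR hk hhi (NstxLike.q0_pos hhi) hr h2r hMhi hi).1 Hhi
    rw [abs_of_pos hhi, lcMercierThreshold_nstx hhi hr h2r] at h
    exact h

/-- Radius bookkeeping: for `0 < c ≤ 1`, the surface `r = c·a` (`a = ε/R_a`) satisfies `0 < r` and `2r < R_a`. [folklore] -/
theorem radius_ok {c : ℝ} (hc : 0 < c) (hc1 : c ≤ 1) :
    0 < NstxLike.ε / NstxLike.Ra * c ∧ 2 * (NstxLike.ε / NstxLike.Ra * c) < NstxLike.Ra := by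
  obtain ⟨ha, h2a⟩ := NstxLike.edge_minorRadius
  refine ⟨by positivity, ?_⟩
  nlinarith

/-- Edge `r = a` (`ψ_N = 1`): `gMercEdgeLo ≤ g_M(a) < gMercEdgeHi` (certified bracket of the NSTX-like row). [cite: Jardin2010, §8.5.4 eq. (8.134)] -/
theorem gMercNstx_edge_mem :
    MercierEdge.gMercEdgeLo ≤ gMercNstx (NstxLike.ε / NstxLike.Ra) ∧ gMercNstx (NstxLike.ε / NstxLike.Ra) < MercierEdge.gMercEdgeHi := by
  obtain ⟨ha, h2a⟩ := NstxLike.edge_minorRadius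
  have hlo : 0 < MercierEdge.gMercEdgeLo := by unfold MercierEdge.gMercEdgeLo; norm_num
  have hhi : 0 < MercierEdge.gMercEdgeHi := by unfold MercierEdge.gMercEdgeHi; norm_num
  exact gMercNstx_mem_of_rows ha h2a hlo hhi (MercierEdge.mercierCriterion_lcEdgeData_of_ge le_rfl)
    (MercierEdge.not_mercierCriterion_lcEdgeData_of_le hlo le_rfl)

/-- `r = 3a/4` (`ψ_N = 9/16`): `gMercQ3Lo ≤ g_M < gMercQ3Hi` (certified bracket of the NSTX-like row). [cite: Jardin2010, §8.5.4 eq. (8.134)] -/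
theorem gMercNstx_q3_mem :
    MercierQ3.gMercQ3Lo ≤ gMercNstx (NstxLike.ε / NstxLike.Ra * (3 / 4))
    ∧ gMercNstx (NstxLike.ε / NstxLike.Ra * (3 / 4)) < MercierQ3.gMercQ3Hi := by
  obtain ⟨hr, h2r⟩ := radius_ok (c := 3 / 4) (by norm_num) (by norm_num)
  have hlo : 0 < MercierQ3.gMercQ3Lo := by unfold MercierQ3.gMercQ3Lo; norm_num
  have hhi : 0 < MercierQ3.gMercQ3Hi := by unfold MercierQ3.gMercQ3Hi; norm_num
  exact gMercNstx_mem_of_rows hr h2r hlo hhi (MercierQ3.mercierCriterion_lcQ3Data_of_ge le_rfl)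
    (MercierQ3.not_mercierCriterion_lcQ3Data_of_le hlo le_rfl)

/-- `r = a/2` (`ψ_N = 1/4`): `gMercMidLo ≤ g_M < gMercMidHi` (certified bracket of the NSTX-like row). [cite: Jardin2010, §8.5.4 eq. (8.134)] -/
theorem gMercNstx_mid_mem :
    MercierMid.gMercMidLo ≤ gMercNstx (NstxLike.ε / NstxLike.Ra / 2) ∧ gMercNstx (NstxLike.ε / NstxLike.Ra / 2) < MercierMid.gMercMidHi := by
  obtain ⟨hr, h2r⟩ := radius_ok (c := 1 / 2) (by norm_num) (by norm_num)
  rw [show NstxLike.ε / NstxLike.Ra * (1 / 2) = NstxLike.ε / NstxLike.Ra / 2 by ring] at hr h2r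
  have hlo : 0 < MercierMid.gMercMidLo := by unfold MercierMid.gMercMidLo; norm_num
  have hhi : 0 < MercierMid.gMercMidHi := by unfold MercierMid.gMercMidHi; norm_num
  exact gMercNstx_mem_of_rows hr h2r hlo hhi (MercierMid.mercierCriterion_lcMidData_of_ge le_rfl)
    (MercierMid.not_mercierCriterion_lcMidData_of_le hlo le_rfl)

/-- `r = a/4` (`ψ_N = 1/16`): `gMercQ1Lo ≤ g_M < gMercQ1Hi` (certified bracket of the NSTX-like row). [cite: Jardin2010, §8.5.4 eq. (8.134)] -/
theorem gMercNstx_q1_mem :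
    MercierQ1.gMercQ1Lo ≤ gMercNstx (NstxLike.ε / NstxLike.Ra * (1 / 4))
    ∧ gMercNstx (NstxLike.ε / NstxLike.Ra * (1 / 4)) < MercierQ1.gMercQ1Hi := by
  obtain ⟨hr, h2r⟩ := radius_ok (c := 1 / 4) (by norm_num) (by norm_num)
  have hlo : 0 < MercierQ1.gMercQ1Lo := by unfold MercierQ1.gMercQ1Lo; norm_num
  have hhi : 0 < MercierQ1.gMercQ1Hi := by unfold MercierQ1.gMercQ1Hi; norm_num
  exact gMercNstx_mem_of_rows hr h2r hlo hhi (MercierQ1.mercierCriterion_lcQ1Data_of_ge le_rfl)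
    (MercierQ1.not_mercierCriterion_lcQ1Data_of_le hlo le_rfl)

/-- `r = a/8` (`ψ_N = 1/64`): `gMercR1o8Lo ≤ g_M < gMercR1o8Hi` (certified bracket of the NSTX-like row). [cite: Jardin2010, §8.5.4 eq. (8.134)] -/
theorem gMercNstx_r1o8_mem :
    MercierR1o8.gMercR1o8Lo ≤ gMercNstx (NstxLike.ε / NstxLike.Ra * (1 / 8))
    ∧ gMercNstx (NstxLike.ε / NstxLike.Ra * (1 / 8)) < MercierR1o8.gMercR1o8Hi := by
  obtain ⟨hr, h2r⟩ := radius_ok (c := 1 / 8) (by norm_num) (by norm_num)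
  have hlo : 0 < MercierR1o8.gMercR1o8Lo := by unfold MercierR1o8.gMercR1o8Lo; norm_num
  have hhi : 0 < MercierR1o8.gMercR1o8Hi := by unfold MercierR1o8.gMercR1o8Hi; norm_num
  exact gMercNstx_mem_of_rows hr h2r hlo hhi (MercierR1o8.mercierCriterion_lcR1o8Data_of_ge le_rfl)
    (MercierR1o8.not_mercierCriterion_lcR1o8Data_of_le hlo le_rfl)

/-- `r = a/16` (`ψ_N = 1/256`): `gMercR1o16Lo ≤ g_M < gMercR1o16Hi` (certified bracket of the NSTX-like row). [cite: Jardin2010, §8.5.4 eq. (8.134)] -/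
theorem gMercNstx_r1o16_mem :
    MercierR1o16.gMercR1o16Lo ≤ gMercNstx (NstxLike.ε / NstxLike.Ra * (1 / 16))
    ∧ gMercNstx (NstxLike.ε / NstxLike.Ra * (1 / 16)) < MercierR1o16.gMercR1o16Hi := by
  obtain ⟨hr, h2r⟩ := radius_ok (c := 1 / 16) (by norm_num) (by norm_num)
  have hlo : 0 < MercierR1o16.gMercR1o16Lo := by unfold MercierR1o16.gMercR1o16Lo; norm_num
  have hhi : 0 < MercierR1o16.gMercR1o16Hi := by unfold MercierR1o16.gMercR1o16Hi; norm_num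
  exact gMercNstx_mem_of_rows hr h2r hlo hhi (MercierR1o16.mercierCriterion_lcR1o16Data_of_ge le_rfl)
    (MercierR1o16.not_mercierCriterion_lcR1o16Data_of_le hlo le_rfl)

/-- **The same function tends to the certified axis threshold:** `gMercNstx r → FmercAxis` as `r → 0⁺`, with
`FmercLo ≤ FmercAxis < FmercHi` (`…MercierAxisLimit.FmercAxis_mem`). [cite: Bateman1978, §7.3 eq. (7.3.2)] -/
theorem tendsto_gMercNstx_axis : Tendsto gMercNstx (𝓝[>] 0) (𝓝 FmercAxis) := by
  have h := tendsto_mercierThreshold_axis (F := 1) one_pos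
  have hR2 : (0 : ℝ) < NstxLike.Ra / 2 := by have := NstxLike.Ra_pos; positivity
  refine h.congr' ?_
  filter_upwards [Ioo_mem_nhdsGT hR2] with r hr
  exact lcMercierThreshold_nstx one_pos hr.1 (by linarith [hr.2])

/-- The certified values are ORDERED toward the axis and lie below the axis limit's bracket:
`g_M(a) < g_M(3a/4) < g_M(a/2) < g_M(a/4) < g_M(a/8) < g_M(a/16) < FmercAxis` (chaining the certified brackets; the last step
uses `gMercR1o16Hi < FmercLo ≤ FmercAxis`). [folklore] -/
theorem gMercNstx_chain :
    gMercNstx (NstxLike.ε / NstxLike.Ra) < gMercNstx (NstxLike.ε / NstxLike.Ra * (3 / 4))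
    ∧ gMercNstx (NstxLike.ε / NstxLike.Ra * (3 / 4)) < gMercNstx (NstxLike.ε / NstxLike.Ra / 2)
    ∧ gMercNstx (NstxLike.ε / NstxLike.Ra / 2) < gMercNstx (NstxLike.ε / NstxLike.Ra * (1 / 4))
    ∧ gMercNstx (NstxLike.ε / NstxLike.Ra * (1 / 4)) < gMercNstx (NstxLike.ε / NstxLike.Ra * (1 / 8))
    ∧ gMercNstx (NstxLike.ε / NstxLike.Ra * (1 / 8)) < gMercNstx (NstxLike.ε / NstxLike.Ra * (1 / 16))
    ∧ gMercNstx (NstxLike.ε / NstxLike.Ra * (1 / 16)) < FmercAxis := by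
  obtain ⟨_, e2⟩ := gMercNstx_edge_mem
  obtain ⟨q31, q32⟩ := gMercNstx_q3_mem
  obtain ⟨m1, m2⟩ := gMercNstx_mid_mem
  obtain ⟨q11, q12⟩ := gMercNstx_q1_mem
  obtain ⟨o81, o82⟩ := gMercNstx_r1o8_mem
  obtain ⟨o161, o162⟩ := gMercNstx_r1o16_mem
  obtain ⟨a1, _⟩ := FmercAxis_mem
  have t1 : MercierEdge.gMercEdgeHi < MercierQ3.gMercQ3Lo := by unfold MercierEdge.gMercEdgeHi MercierQ3.gMercQ3Lo; norm_num
  have t2 : MercierQ3.gMercQ3Hi < MercierMid.gMercMidLo := by unfold MercierQ3.gMercQ3Hi MercierMid.gMercMidLo; norm_num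
  have t3 : MercierMid.gMercMidHi < MercierQ1.gMercQ1Lo := by unfold MercierMid.gMercMidHi MercierQ1.gMercQ1Lo; norm_num
  have t4 : MercierQ1.gMercQ1Hi < MercierR1o8.gMercR1o8Lo := by unfold MercierQ1.gMercQ1Hi MercierR1o8.gMercR1o8Lo; norm_num
  have t5 : MercierR1o8.gMercR1o8Hi < MercierR1o16.gMercR1o16Lo := by
    unfold MercierR1o8.gMercR1o8Hi MercierR1o16.gMercR1o16Lo; norm_num
  have t6 : MercierR1o16.gMercR1o16Hi < MercierAxis.FmercLo := by unfold MercierR1o16.gMercR1o16Hi MercierAxis.FmercLo; norm_num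
  exact ⟨by linarith, by linarith, by linarith, by linarith, by linarith, by linarith⟩

end Summit.Ventures.FusionMHD.Bench.SolovevPCFNstx.MercierProfileFunction

end
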